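import Summits.BirchSwinnertonDyer.BirchSwinnertonDyer.Theorems.DerivedCoinvariantProfileAtPoint
import Literature.NumberTheory.EllipticCurves.KatoRankBoundAllPrimesProofs
import Literature.NumberTheory.EllipticCurves.SelmerCorankControlRatOrdinaryProofs
import Literature.NumberTheory.EllipticCurves.SkinnerUrban2014.ShaOrderOfMainConjectureProofs
import HarnessLib

/-!
# The derived coinvariant profile, III: the rank-`≥ 2` inequality and the exact defect identity
# with every Iwasawa-theoretic input DISCHARGED to named print facts and tree theorems — helper

Sequel to `DerivedCoinvariantProfile` / `DerivedCoinvariantProfileAtPoint` (cell `bsd-rank2`, seat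
p2, GEN 70; `--supports` the open leaf `DepletedLambdaLawAtTwoModNSF` of route
`EisensteinDepletionAtTwo`). Part II proved, at a point `(E, p, f, κ, γ, D)` and under the RAW
hypotheses (KD) "`X(E/ℚ_∞)` is `Λ`-torsion and `p^n L_p(E,T) ∈ ι(char_Λ X)`" and (CT)
"`rank_{ℤ_p} X/TX = corank Sel_{p^∞}(E/ℚ)`":
`rank E(ℚ) + corank_{ℤ_p} Ш(E/ℚ)[p^∞] + ∑_{i ≥ 2} e_i(X(E/ℚ_∞)) ≤ ord_{T=0} L_p(E,T)`
(`e_{i+1}(X) = derivedLength X i = ℓ_{(T)}(T^iX/T^{i+1}X)`, the dimension of the domain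
`S_p^{(i+1)}` of the `(i+1)`-st derived `p`-adic height [Howard2004DerivedHeights, Thm. 5.2]).
This file removes the raw hypotheses. What remains as a HYPOTHESIS is exactly a named, refereed,
vendored Literature fact, used in the tree's standard way `(h : Fact)`:

* (KD) ⇐ clauses (1)(2) of `kato_divisibility W p` [Kato2004Asterisque, Thm. 17.4 (p. 273)] at an
  ODD good ordinary prime (`kato_divisibility.torsion_and_charIdeal_dvd`); at ANY prime (`p = 2`
  included) ⇐ the parity-free clauses (1)(2) in the spelling `hdiv` of
  `kato_selmerCorank_le_order_padicLFunction_allPrimes_of_divisibility`;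
* (CT) ⇐ the tree THEOREM `Greenberg1999_coinvariantsRank_eq_selmerCorank_rat_holds`
  [GreenbergLNM1716, Thm. 1.2] (sorry-free in `SelmerCorankControlRatOrdinaryProofs`) — no
  hypothesis at all;
* (MC_T) `ℓ_{(T)}(X) = ord_{T=0} L_p` ⇐ clause (2) of `skinner_urban_main_conjecture W p`
  [SkinnerUrban2014, Thm. 3.6.9] on its locus (`p ≥ 3` good ordinary, `ρ̄_{E,p}` irreducible, a
  multiplicative prime `ℓ ≠ p` with `p ∤ v_ℓ(Δ_E)`), via `ord_T ι(g) = ord_T g = ℓ_{(T)}(X)`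
  (`order_iwasawaToPowerSeries`, `order_eq_toNat_lengthAt`);
* the cyclotomic setting `(κ, γ)` and the datum `D` EXIST for every `p` (tree theorems
  `exists_isCyclotomic_isTopGenerator_isCyclotomicVariable_holds`, `nonempty_selmerDualData_holds`).

## Results (all sorry-free; `L_p = padicLFunction f (unitRoot W p)`, `X = D.X = X(E/ℚ_∞)`)

§1 For EVERY `E/ℚ` and every odd good ordinary `p`, hypothesis `kato_divisibility W p` only:
`rank E(ℚ) + corank Ш(E/ℚ)[p^∞] + ∑_{1 ≤ i ≤ n} e_{i+1}(X) ≤ ord_{T=0} L_p(E,T)` for all `n`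
(`rank_add_shaCorank_add_sum_derivedLength_le_order_of_kato`), in particular
`rank + corank Ш[p^∞] + e_2(X) ≤ ord_T L_p`; the datum-free form `∃ (κ, γ, D), ∀ n, …`; and the
same at every prime from Kato 17.4 (1)(2) at that prime (`…_of_divisibility`).
§2 On the Skinner–Urban locus, hypothesis `skinner_urban_main_conjecture W p` only: (MC_T) at the
point (`isTorsion_and_lengthAt_eq_order_of_skinnerUrban`); the EXACT identity
`ord_{T=0} L_p(E,T) = rank E(ℚ) + corank Ш(E/ℚ)[p^∞] + ∑_{i ≥ 2} e_i(X(E/ℚ_∞))`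
(`order_eq_rank_add_shaCorank_add_sum_derivedLength_of_skinnerUrban`); the equality DOOR
`ord_{T=0} L_p = rank E(ℚ) ⟺ e_2(X(E/ℚ_∞)) = 0 ∧ corank Ш(E/ℚ)[p^∞] = 0`
(`order_eq_rank_iff_of_skinnerUrban`); and at Selmer corank `2`, given Howard's parity constraint
at `r = 2` (hypothesis), `ord_T L_p ∈ {2} ∪ [4, ∞)`.
§3 The squeeze, hypothesis `kato_divisibility W p` only: if `ord_{T=0} L_p ≤ rank E(ℚ)` then
`corank Ш[p^∞] = 0`, `e_i(X) = 0` for all `i ≥ 2`, (MC_T) holds and `ord_T L_p = rank`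
(`defects_eq_zero_of_order_le_rank_of_kato`) — equality can only be reached with ALL defects zero.

## What this answers, and Barrier-B1 honesty

Purpose [rank2-p2]: "what `p`-adic BSD gives at rank `≥ 2` unconditionally as kernel theorems …
and the exact extra input that turns the inequality into equality on an infinite class". §1 is the
Literature-grade inequality for all `E` (its only hypothesis is the vendored print fact Kato
Thm. 17.4; it refines the tree's corank form `kato_selmerCorank_le_order_padicLFunction_allPrimes*`
by the whole higher derived profile). §2 types the door on an infinite class (the Skinner–Urban
locus, for each fixed `p ≥ 3` infinitely many `E`): equality ⟺ `Ш(E/ℚ)[p^∞]` finite ∧ `e_2 = 0`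
(non-degeneracy of the classical cyclotomic `p`-adic height on `S_p^{(1)}` modulo its kernel
`S_p^{(2)}`, [Howard2004DerivedHeights, Cor. 5.3]; Schneider's conjecture). NO motion on S0 is
claimed: both inputs are open at rank `≥ 2` (barrier B1 = `Ш[p^∞]`-finiteness off the
Gross–Zagier–Kolyvagin range; Howard: "it is not known that `e_i = 0` for `i > 1`"); the file
LOCATES them with named-fact precision and proves (§3) that nothing weaker can give equality.

References: [Kato2004Asterisque] Astérisque 295 (2004), Thm. 17.4, Thm. 18.4; [GreenbergLNM1716]
LNM 1716 (1999), Thm. 1.2, §1 p. 65; [SkinnerUrban2014] Invent. Math. 195 (2014), Thm. 3.6.9;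
[Howard2004DerivedHeights] Amer. J. Math. 126 (2004), Thm. 5.2, Cor. 5.3; [BertoliniDarmon1995]
Amer. J. Math. 117 (1995), §2; [Schneider1985] Invent. Math. 79 (1985).
-/

-- D-0017: single-problem summit, so `Summit.BirchSwinnertonDyer.BirchSwinnertonDyer.…` repeats a
-- namespace BY DESIGN.
set_option linter.dupNamespace false

noncomputable section
open scoped BigOperators
universe u

namespace Summit.BirchSwinnertonDyer.BirchSwinnertonDyer.Theorems.DerivedCoinvariantProfileDischarged

open Literature.NumberTheory.EllipticCurves Literature.NumberTheory.EllipticCurves.IwasawaAlgebra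
  Literature.NumberTheory.EllipticCurves.ModularForms
open Summit.BirchSwinnertonDyer.BirchSwinnertonDyer.Theorems.DerivedCoinvariantProfile
  Summit.BirchSwinnertonDyer.BirchSwinnertonDyer.Theorems.DerivedCoinvariantProfileAtPoint
open scoped MatrixGroups ModularForm
open CongruenceSubgroup

variable (p : ℕ) [Fact p.Prime]
variable (W : WeierstrassCurve ℚ) [W.IsElliptic] [W.IsGloballyMinimal]
  {N : ℕ} [NeZero N] (f : CuspForm (Gamma0 N) 2)
  {κ : ZpExtension ℚ p} {γ : Field.absoluteGaloisGroup ℚ}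

/-! ## §1 The rank-`≥ 2` inequality for every `E`, from Kato's Thm. 17.4 alone -/

/-- **Derived rank-`≥ 2` inequality, discharged form (odd `p`).** Let `E/ℚ` (globally minimal `W`)
be good ordinary at the odd prime `p`, `f` its newform, `(κ, γ)` the cyclotomic `ℤ_p`-extension with
normalised topological generator matching the cyclotomic variable, `X = X(E/ℚ_∞)` (`D`). Assume
ONLY the named print fact `kato_divisibility W p` (Kato, Astérisque 295, Thm. 17.4 (1)(2)). Then
for every `n`:
`rank E(ℚ) + corank_{ℤ_p} Ш(E/ℚ)[p^∞] + ∑_{1 ≤ i ≤ n} e_{i+1}(X) ≤ ord_{T=0} L_p(E,T)`.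
Mazur control (CT) is the tree theorem `Greenberg1999_coinvariantsRank_eq_selmerCorank_rat_holds`
(Greenberg LNM 1716 Thm. 1.2), not a hypothesis. Refines Kato's Thm. 18.4
`corank Sel_{p^∞}(E/ℚ) ≤ ord_T L_p` by the higher derived coinvariant profile (each degenerate
derived height direction costs a zero). [cite: Kato2004Asterisque, Thm. 17.4 (p. 273) and Thm. 18.4 (p. 281)]
[cite: GreenbergLNM1716, Thm. 1.2] [cite: Howard2004DerivedHeights, Thm. 5.2] [cite: BertoliniDarmon1995, §2] -/
theorem rank_add_shaCorank_add_sum_derivedLength_le_order_of_kato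
    (hK : kato_divisibility W p (κ := κ) (γ := γ) (f := f)) (hp : p ≠ 2)
    (hord : IsOrdinaryAt W p) (hκ : κ.IsCyclotomic) (hγ : κ.IsTopGenerator γ)
    (hγ' : IsCyclotomicVariable p γ) (hf : IsNewformOf W f) (D : W.SelmerDualData κ γ) (n : ℕ) :
    (W.mordellWeilRank : ℕ∞) + W.shaCorank p + ∑ i ∈ Finset.Ico 1 (n + 1), derivedLength p D.X i ≤
      (padicLFunction f (unitRoot W p : ℚ_[p])).order := by
  obtain ⟨htors, hKD⟩ := kato_divisibility.torsion_and_charIdeal_dvd W p hK hp hκ hγ hγ' hord hf D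
  exact rank_add_shaCorank_add_sum_derivedLength_le_order p W f hκ hγ D htors hKD
    (Greenberg1999_coinvariantsRank_eq_selmerCorank_rat_holds W p hord.1 hord.2 κ γ hκ hγ D).2 n

/-- **The first higher term alone**: under `kato_divisibility W p` at an odd good ordinary `p`,
`rank E(ℚ) + corank_{ℤ_p} Ш(E/ℚ)[p^∞] + e_2(X(E/ℚ_∞)) ≤ ord_{T=0} L_p(E,T)`, where
`e_2(X) = ℓ_{(T)}(TX/T²X) = dim S_p^{(2)}(E/ℚ)` is the rank of the KERNEL of the classical
cyclotomic `p`-adic height on the `p^∞`-Selmer group (Howard, Cor. 5.3, first bullet).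
[cite: Kato2004Asterisque, Thm. 17.4 (p. 273)] [cite: Howard2004DerivedHeights, Cor. 5.3] -/
theorem rank_add_shaCorank_add_derivedLength_one_le_order_of_kato
    (hK : kato_divisibility W p (κ := κ) (γ := γ) (f := f)) (hp : p ≠ 2)
    (hord : IsOrdinaryAt W p) (hκ : κ.IsCyclotomic) (hγ : κ.IsTopGenerator γ)
    (hγ' : IsCyclotomicVariable p γ) (hf : IsNewformOf W f) (D : W.SelmerDualData κ γ) :
    (W.mordellWeilRank : ℕ∞) + W.shaCorank p + derivedLength p D.X 1 ≤
      (padicLFunction f (unitRoot W p : ℚ_[p])).order := by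
  have h := rank_add_shaCorank_add_sum_derivedLength_le_order_of_kato p W f hK hp hord hκ hγ hγ' hf D 1
  rwa [Nat.Ico_succ_singleton, Finset.sum_singleton] at h

/-- **Datum-free form.** For every `E/ℚ` (globally minimal `W`), every odd good ordinary `p` and the
newform `f` of `E`, assuming `kato_divisibility W p` at every cyclotomic datum: there EXIST the
cyclotomic `ℤ_p`-extension `κ`, a normalised generator `γ` matching the cyclotomic variable and the
Iwasawa module `X = X(E/ℚ_∞)` (all tree constructions), and for them
`rank E(ℚ) + corank Ш(E/ℚ)[p^∞] + ∑_{1 ≤ i ≤ n} e_{i+1}(X) ≤ ord_{T=0} L_p(E,T)` for every `n`.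
[cite: Kato2004Asterisque, Thm. 17.4 (p. 273) and Thm. 18.4 (p. 281)] [cite: Washington1997, §13.1] -/
theorem exists_datum_rank_add_shaCorank_add_sum_derivedLength_le_order_of_kato (hp : p ≠ 2)
    (hord : IsOrdinaryAt W p) (hf : IsNewformOf W f)
    (hK : ∀ (κ : ZpExtension ℚ p) (γ : Field.absoluteGaloisGroup ℚ),
      kato_divisibility W p (κ := κ) (γ := γ) (f := f)) :
    ∃ (κ : ZpExtension ℚ p) (γ : Field.absoluteGaloisGroup ℚ) (D : W.SelmerDualData κ γ),
      κ.IsCyclotomic ∧ κ.IsTopGenerator γ ∧ IsCyclotomicVariable p γ ∧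
      ∀ n : ℕ, (W.mordellWeilRank : ℕ∞) + W.shaCorank p +
          ∑ i ∈ Finset.Ico 1 (n + 1), derivedLength p D.X i ≤
        (padicLFunction f (unitRoot W p : ℚ_[p])).order := by
  obtain ⟨κ, hκ, γ, hγ, hγ'⟩ := exists_isCyclotomic_isTopGenerator_isCyclotomicVariable_holds p
  obtain ⟨D⟩ := W.nonempty_selmerDualData_holds κ γ hγ
  exact ⟨κ, γ, D, hκ, hγ, hγ', fun n ↦
    rank_add_shaCorank_add_sum_derivedLength_le_order_of_kato p W f (hK κ γ) hp hord hκ hγ hγ' hf D n⟩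

/-- **Every prime, `p = 2` included, from Kato Thm. 17.4 (1)(2) AT THAT PRIME.** The hypothesis
`hdiv` is clauses (1)(2) of Kato's Thm. 17.4 in the parity-free spelling of
`kato_selmerCorank_le_order_padicLFunction_allPrimes_of_divisibility` (printed without parity
restriction, p. 273; 17.13: "(17.13.1) is exact if `p ≠ 2`, and is exact upto `×2` in the case
`p = 2`"; the tree vendors it at odd `p` only). Conclusion as in
`rank_add_shaCorank_add_sum_derivedLength_le_order_of_kato`.
[cite: Kato2004Asterisque, Thm. 17.4 (1)(2) (p. 273) and 17.13 (p. 279)] [cite: GreenbergLNM1716, Thm. 1.2] -/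
theorem rank_add_shaCorank_add_sum_derivedLength_le_order_of_divisibility
    (hdiv : ∀ (κ : ZpExtension ℚ p) (γ : Field.absoluteGaloisGroup ℚ), κ.IsCyclotomic →
      κ.IsTopGenerator γ → IsCyclotomicVariable p γ → IsOrdinaryAt W p → IsNewformOf W f →
      ∀ D : W.SelmerDualData κ γ, D.IsTorsion ∧
        ∃ (n : ℕ) (g : IwasawaAlgebra p), g ∈ D.charIdeal ∧
          iwasawaToPowerSeries p g =
            PowerSeries.C ((p : ℚ_[p]) ^ n) * padicLFunction f (unitRoot W p : ℚ_[p]))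
    (hord : IsOrdinaryAt W p) (hf : IsNewformOf W f) (hκ : κ.IsCyclotomic)
    (hγ : κ.IsTopGenerator γ) (hγ' : IsCyclotomicVariable p γ) (D : W.SelmerDualData κ γ) (n : ℕ) :
    (W.mordellWeilRank : ℕ∞) + W.shaCorank p + ∑ i ∈ Finset.Ico 1 (n + 1), derivedLength p D.X i ≤
      (padicLFunction f (unitRoot W p : ℚ_[p])).order := by
  obtain ⟨htors, hKD⟩ := hdiv κ γ hκ hγ hγ' hord hf D
  exact rank_add_shaCorank_add_sum_derivedLength_le_order p W f hκ hγ D htors hKD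
    (Greenberg1999_coinvariantsRank_eq_selmerCorank_rat_holds W p hord.1 hord.2 κ γ hκ hγ D).2 n

/-! ## §2 On the Skinner–Urban locus: (MC_T) discharged, the exact defect identity, the door -/

/-- **(MC_T) at a point from Skinner–Urban.** On the Skinner–Urban locus (`p ≥ 3` good ordinary,
`ρ̄_{E,p}` irreducible, a multiplicative prime `ℓ ≠ p` with `p ∤ v_ℓ(Δ_E)`), assuming ONLY the
named print fact `skinner_urban_main_conjecture W p` (Invent. Math. 195, Thm. 3.6.9, clause (2):
`char_Λ X = (g)`, `ι g = p^k L_p(E,T)`): `X(E/ℚ_∞)` is `Λ`-torsion and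
`ℓ_{(T)}(X(E/ℚ_∞)) = ord_{T=0} L_p(E,T)` — `ord_T L_p = ord_T ι(g) = ord_T g = ℓ_{(T)}(X)`
(`order_iwasawaToPowerSeries`, `order_eq_toNat_lengthAt`).
[cite: SkinnerUrban2014, Thm. 3.6.9 (p. 45)] [cite: Washington1997, §13.2] -/
theorem isTorsion_and_lengthAt_eq_order_of_skinnerUrban
    (hSU : skinner_urban_main_conjecture W p (κ := κ) (γ := γ) (f := f)) (hp : 3 ≤ p)
    (hord : IsOrdinaryAt W p) (hirr : W.HasIrreducibleModPGaloisRep p)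
    (haux : ∃ ℓ : ℕ, ∃ _ : Fact ℓ.Prime, ℓ ≠ p ∧ W.HasMultiplicativeReductionAtPrime ℓ ∧
      ¬ p ∣ padicValInt ℓ W.minimalDiscriminantInt)
    (hκ : κ.IsCyclotomic) (hγ : κ.IsTopGenerator γ) (hγ' : IsCyclotomicVariable p γ)
    (hf : IsNewformOf W f) (D : W.SelmerDualData κ γ) :
    D.IsTorsion ∧ Module.lengthAt (IwasawaAlgebra p) D.X (primeT p) =
      (padicLFunction f (unitRoot W p : ℚ_[p])).order := by
  haveI : Module.Finite (IwasawaAlgebra p) D.X := D.module_finite_of_isCyclotomic W κ hκ hγ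
  obtain ⟨htors, ⟨g, k, hg, hιg⟩, -⟩ := hSU hp hord.1 hord.2 hirr haux hκ hγ hγ' hf D
  refine ⟨htors, ?_⟩
  have hpk : IsUnit (PowerSeries.C ((p : ℚ_[p]) ^ k)) := by
    refine IsUnit.map PowerSeries.C (IsUnit.mk0 _ (zpow_ne_zero k ?_))
    exact_mod_cast (Fact.out : p.Prime).ne_zero
  have h2 : (iwasawaToPowerSeries p g).order =
      (padicLFunction f (unitRoot W p : ℚ_[p])).order := by
    rw [hιg, PowerSeries.order_mul, PowerSeries.order_zero_of_unit hpk, zero_add]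
  rw [← h2, order_iwasawaToPowerSeries, order_eq_toNat_lengthAt p htors g hg (primeT p)
    (primeT_asIdeal p), ENat.coe_toNat (lengthAt_primeT_ne_top D.X htors)]

/-- **The exact defect identity on the Skinner–Urban locus, discharged.** Assuming ONLY
`skinner_urban_main_conjecture W p` (Thm. 3.6.9) — control being the tree theorem
`Greenberg1999_coinvariantsRank_eq_selmerCorank_rat_holds` — for `p ≥ 3` good ordinary with
`ρ̄_{E,p}` irreducible and a multiplicative `ℓ ≠ p` with `p ∤ v_ℓ(Δ_E)`: for all large `n`,
`ord_{T=0} L_p(E,T) = rank E(ℚ) + corank_{ℤ_p} Ш(E/ℚ)[p^∞] + ∑_{1 ≤ i ≤ n} e_{i+1}(X(E/ℚ_∞))`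
and `e_{n+2}(X) = 0`. The `p`-adic BSD defect `ord_T L_p - rank` on this infinite class is EXACTLY
the `p`-Ш corank plus the higher derived profile (algebraic side of the Bertolini–Darmon /
Howard derived height formula `ord = ∑_r dim S_p^{(r)}`).
[cite: SkinnerUrban2014, Thm. 3.6.9 (p. 45)] [cite: GreenbergLNM1716, Thm. 1.2 and §1 p. 65]
[cite: BertoliniDarmon1995, §2] [cite: Howard2004DerivedHeights, Thm. 5.2 and Cor. 5.3] -/
theorem order_eq_rank_add_shaCorank_add_sum_derivedLength_of_skinnerUrban
    (hSU : skinner_urban_main_conjecture W p (κ := κ) (γ := γ) (f := f)) (hp : 3 ≤ p)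
    (hord : IsOrdinaryAt W p) (hirr : W.HasIrreducibleModPGaloisRep p)
    (haux : ∃ ℓ : ℕ, ∃ _ : Fact ℓ.Prime, ℓ ≠ p ∧ W.HasMultiplicativeReductionAtPrime ℓ ∧
      ¬ p ∣ padicValInt ℓ W.minimalDiscriminantInt)
    (hκ : κ.IsCyclotomic) (hγ : κ.IsTopGenerator γ) (hγ' : IsCyclotomicVariable p γ)
    (hf : IsNewformOf W f) (D : W.SelmerDualData κ γ) :
    ∃ n₀ : ℕ, ∀ n, n₀ ≤ n →
      (padicLFunction f (unitRoot W p : ℚ_[p])).order =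
          (W.mordellWeilRank : ℕ∞) + W.shaCorank p +
            ∑ i ∈ Finset.Ico 1 (n + 1), derivedLength p D.X i ∧
        derivedLength p D.X (n + 1) = 0 := by
  obtain ⟨htors, hMCT⟩ :=
    isTorsion_and_lengthAt_eq_order_of_skinnerUrban p W f hSU hp hord hirr haux hκ hγ hγ' hf D
  exact order_eq_rank_add_shaCorank_add_sum_derivedLength_of_MCT p W f hκ hγ D htors
    (Greenberg1999_coinvariantsRank_eq_selmerCorank_rat_holds W p hord.1 hord.2 κ γ hκ hγ D).2 hMCT

/-- **The equality door on the Skinner–Urban locus, discharged.** Assuming ONLY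
`skinner_urban_main_conjecture W p`: for `p ≥ 3` good ordinary with `ρ̄_{E,p}` irreducible and a
multiplicative `ℓ ≠ p` with `p ∤ v_ℓ(Δ_E)`,
`ord_{T=0} L_p(E,T) = rank E(ℚ)` **iff** `e_2(X(E/ℚ_∞)) = 0` **and** `corank_{ℤ_p} Ш(E/ℚ)[p^∞] = 0`.
The two conjuncts are the EXACT extra inputs of `p`-adic BSD (rank part) on this infinite class:
`Ш(E/ℚ)[p^∞]` finite (barrier B1 at rank `≥ 2`) and the non-degeneracy of the classical cyclotomic
`p`-adic height modulo its kernel `S_p^{(2)}` (Howard Cor. 5.3; Schneider) — both open at rank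
`≥ 2`, neither claimed. [cite: SkinnerUrban2014, Thm. 3.6.9 (p. 45)]
[cite: Howard2004DerivedHeights, Cor. 5.3] [cite: GreenbergLNM1716, §1 Conj. 1.12–1.13 and p. 65]
[cite: Schneider1985, §1] -/
theorem order_eq_rank_iff_of_skinnerUrban
    (hSU : skinner_urban_main_conjecture W p (κ := κ) (γ := γ) (f := f)) (hp : 3 ≤ p)
    (hord : IsOrdinaryAt W p) (hirr : W.HasIrreducibleModPGaloisRep p)
    (haux : ∃ ℓ : ℕ, ∃ _ : Fact ℓ.Prime, ℓ ≠ p ∧ W.HasMultiplicativeReductionAtPrime ℓ ∧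
      ¬ p ∣ padicValInt ℓ W.minimalDiscriminantInt)
    (hκ : κ.IsCyclotomic) (hγ : κ.IsTopGenerator γ) (hγ' : IsCyclotomicVariable p γ)
    (hf : IsNewformOf W f) (D : W.SelmerDualData κ γ) :
    (padicLFunction f (unitRoot W p : ℚ_[p])).order = W.mordellWeilRank ↔
      derivedLength p D.X 1 = 0 ∧ W.shaCorank p = 0 := by
  haveI : Module.Finite (IwasawaAlgebra p) D.X := D.module_finite_of_isCyclotomic W κ hκ hγ
  obtain ⟨htors, hMCT⟩ :=
    isTorsion_and_lengthAt_eq_order_of_skinnerUrban p W f hSU hp hord hirr haux hκ hγ hγ' hf D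
  have hctrl : coinvariantsRank p D.X = W.selmerCorank p :=
    (Greenberg1999_coinvariantsRank_eq_selmerCorank_rat_holds W p hord.1 hord.2 κ γ hκ hγ D).2
  have hid : W.selmerCorank p = W.mordellWeilRank + W.shaCorank p :=
    W.selmerCorank_eq_mordellWeilRank_add_holds p
  have hcrit := lengthAt_eq_coinvariantsRank_iff_derivedLength_one_eq_zero p D.X htors
  have hc1 : (coinvariantsRank p D.X : ℕ∞) ≤ Module.lengthAt (IwasawaAlgebra p) D.X (primeT p) :=
    coinvariantsRank_le_lengthAt_primeT D.X
  rw [← hMCT]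
  obtain ⟨ℓ, hℓ⟩ := ENat.ne_top_iff_exists.mp (lengthAt_primeT_ne_top D.X htors)
  rw [← hℓ] at hc1 hcrit ⊢
  rw [hctrl, hid] at hc1 hcrit
  have hc1' : W.mordellWeilRank + W.shaCorank p ≤ ℓ := by exact_mod_cast hc1
  constructor
  · intro h
    have h' : ℓ = W.mordellWeilRank := by exact_mod_cast h
    have hsha : W.shaCorank p = 0 := by omega
    exact ⟨hcrit.mp (by exact_mod_cast (show ℓ = W.mordellWeilRank + W.shaCorank p by omega)), hsha⟩
  · rintro ⟨h1, hsha⟩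
    have h := hcrit.mpr h1
    rw [h, hsha, Nat.add_zero]

/-- **At Selmer corank `2` on the Skinner–Urban locus: `ord_T L_p = 2` or `≥ 4`.** Assuming ONLY
`skinner_urban_main_conjecture W p`, and Howard's parity constraint at `r = 2` for `X(E/ℚ_∞)`
(an even number of blocks `Λ/(T²)` at `(T)`: the second derived height is ALTERNATING
[Howard2004DerivedHeights, Cor. 5.3], a HYPOTHESIS `hH` here, the named Literature fact not yet
typed): if `corank_{ℤ_p} Sel_{p^∞}(E/ℚ) = 2` then `ord_{T=0} L_p(E,T) = 2` or `ord_{T=0} L_p ≥ 4`.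
[cite: SkinnerUrban2014, Thm. 3.6.9 (p. 45)] [cite: Howard2004DerivedHeights, Cor. 5.3]
[cite: GreenbergLNM1716, Prop. 3.10] -/
theorem order_eq_two_or_four_le_of_skinnerUrban_of_even_blocks_two
    (hSU : skinner_urban_main_conjecture W p (κ := κ) (γ := γ) (f := f)) (hp : 3 ≤ p)
    (hord : IsOrdinaryAt W p) (hirr : W.HasIrreducibleModPGaloisRep p)
    (haux : ∃ ℓ : ℕ, ∃ _ : Fact ℓ.Prime, ℓ ≠ p ∧ W.HasMultiplicativeReductionAtPrime ℓ ∧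
      ¬ p ∣ padicValInt ℓ W.minimalDiscriminantInt)
    (hκ : κ.IsCyclotomic) (hγ : κ.IsTopGenerator γ) (hγ' : IsCyclotomicVariable p γ)
    (hf : IsNewformOf W f) (D : W.SelmerDualData κ γ)
    (hH : ∃ m : ℕ, derivedLength p D.X 1 = derivedLength p D.X 2 + 2 * (m : ℕ∞))
    (hs : W.selmerCorank p = 2) :
    (padicLFunction f (unitRoot W p : ℚ_[p])).order = 2 ∨
      4 ≤ (padicLFunction f (unitRoot W p : ℚ_[p])).order := by
  obtain ⟨htors, hMCT⟩ :=
    isTorsion_and_lengthAt_eq_order_of_skinnerUrban p W f hSU hp hord hirr haux hκ hγ hγ' hf D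
  exact order_eq_two_or_four_le_of_MCT_of_even_blocks_two p W f hκ hγ D htors
    (Greenberg1999_coinvariantsRank_eq_selmerCorank_rat_holds W p hord.1 hord.2 κ γ hκ hγ D).2
    hMCT hH hs

/-! ## §3 The squeeze: equality forces every defect to vanish (Kato only) -/

/-- **Squeeze.** Under ONLY `kato_divisibility W p` at an odd good ordinary `p`: if
`ord_{T=0} L_p(E,T) ≤ rank E(ℚ)` (e.g. an analytic upper bound meeting the Mordell–Weil rank),
then `corank_{ℤ_p} Ш(E/ℚ)[p^∞] = 0` (so `Ш(E/ℚ)[p^∞]` is finite), EVERY higher derived coinvariant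
length vanishes (`e_{i+1}(X(E/ℚ_∞)) = 0` for `i ≥ 1`: all derived `p`-adic heights beyond the first
have trivial domain modulo the next), the main conjecture holds at `(T)`
(`ℓ_{(T)}(X) = ord_{T=0} L_p`), and `ord_{T=0} L_p = rank E(ℚ)`. So on any class, `p`-adic BSD
(rank part) is EQUIVALENT to the simultaneous vanishing of all the defects of §1 — there is no
cheaper door. [cite: Kato2004Asterisque, Thm. 17.4 (p. 273) and Thm. 18.4 (p. 281)]
[cite: GreenbergLNM1716, Thm. 1.2 and §1 p. 65] [cite: BertoliniDarmon1995, §2] -/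
theorem defects_eq_zero_of_order_le_rank_of_kato
    (hK : kato_divisibility W p (κ := κ) (γ := γ) (f := f)) (hp : p ≠ 2)
    (hord : IsOrdinaryAt W p) (hκ : κ.IsCyclotomic) (hγ : κ.IsTopGenerator γ)
    (hγ' : IsCyclotomicVariable p γ) (hf : IsNewformOf W f) (D : W.SelmerDualData κ γ)
    (hle : (padicLFunction f (unitRoot W p : ℚ_[p])).order ≤ W.mordellWeilRank) :
    W.shaCorank p = 0 ∧ (∀ i, 1 ≤ i → derivedLength p D.X i = 0) ∧
      Module.lengthAt (IwasawaAlgebra p) D.X (primeT p) =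
        (padicLFunction f (unitRoot W p : ℚ_[p])).order ∧
      (padicLFunction f (unitRoot W p : ℚ_[p])).order = W.mordellWeilRank := by
  haveI : Module.Finite (IwasawaAlgebra p) D.X := D.module_finite_of_isCyclotomic W κ hκ hγ
  obtain ⟨htors, hKD⟩ := kato_divisibility.torsion_and_charIdeal_dvd W p hK hp hκ hγ hγ' hord hf D
  have hctrl : coinvariantsRank p D.X = W.selmerCorank p :=
    (Greenberg1999_coinvariantsRank_eq_selmerCorank_rat_holds W p hord.1 hord.2 κ γ hκ hγ D).2
  have hid : W.selmerCorank p = W.mordellWeilRank + W.shaCorank p :=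
    W.selmerCorank_eq_mordellWeilRank_add_holds p
  -- the two one-term consequences of §1 with `n = 1`
  have hineq :=
    rank_add_shaCorank_add_derivedLength_one_le_order_of_kato p W f hK hp hord hκ hγ hγ' hf D
  have h0 : (W.shaCorank p : ℕ∞) + derivedLength p D.X 1 ≤ 0 := by
    rw [← ENat.add_le_add_iff_left (ENat.coe_ne_top W.mordellWeilRank), add_zero, ← add_assoc]
    exact hineq.trans hle
  have hsha : W.shaCorank p = 0 := by
    exact_mod_cast (nonpos_iff_eq_zero.mp (le_self_add.trans h0) : (W.shaCorank p : ℕ∞) = 0)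
  have he1 : derivedLength p D.X 1 = 0 := nonpos_iff_eq_zero.mp (le_add_self.trans h0)
  -- the chain `rank ≤ rank + corank Ш = rank X/TX ≤ ℓ_{(T)}(X) ≤ ord_T L_p ≤ rank`
  have hKD' := lengthAt_le_order_padicLFunction_of_KD p W f D htors hKD
  have hlow : (W.mordellWeilRank : ℕ∞) ≤ Module.lengthAt (IwasawaAlgebra p) D.X (primeT p) := by
    refine le_trans ?_ (coinvariantsRank_le_lengthAt_primeT D.X)
    rw [hctrl, hid]
    exact_mod_cast Nat.le_add_right _ _
  exact ⟨hsha, fun i hi ↦ derivedLength_eq_zero_of_eq_zero p hi he1,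
    le_antisymm hKD' (hle.trans hlow), le_antisymm hle (hlow.trans hKD')⟩

end Summit.BirchSwinnertonDyer.BirchSwinnertonDyer.Theorems.DerivedCoinvariantProfileDischarged
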